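import Literature.MathematicalPhysics.StatisticalMechanics.BarlowStackingHeights
import Literature.MathematicalPhysics.StatisticalMechanics.BarlowStackingEnergy
import Literature.MathematicalPhysics.StatisticalMechanics.LayerSumDecay
import Summits.AtomisticToContinuum.Crystallization.Theorems.HullExactificationCascadeHullBulkOptimalCut
import Summits.AtomisticToContinuum.Crystallization.Theorems.MinMeanCycleStackingLockBarlowEnergyIdentification
import Summits.AtomisticToContinuum.Crystallization.Theorems.PhononSlackCertificatesPeriodicGivenLayeredLayerCake3

/-!
# Crux `HcpLandscapeGap` (stmt-AtomisticToContinuum-12087), line `birth` — stub RS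
# `stub_siteEnergyHeights`

STUB RS of the skeleton `Cruxes/HcpLandscapeGap/Lines/birth.lean` (v10, the relaxed-Barlow cut):
the layer-by-layer decomposition of the FULL Lennard-Jones site energy of one point
`p = barlowPosH a H s m i j` of a Barlow multilattice `barlowStackingH a H s` (perfect triangular
layers of spacing `a ∈ [47/50, 1]` in the planes `x₃ = H k`, `A/B/C` registry read off the Hägg
word `s`, ARBITRARY heights `H` with every spacing in `[39a/50, 17a/20]`):

* the family `z ↦ V_LJ(dist p z)` over the other points of the multilattice is summable;
* the layer series `k ↦ layerInteraction V_LJ a (H k − H m) (haggLabel s k − haggLabel s m) 1`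
  (`k ≠ m`) is summable;
* `Σ'_{z ≠ p} V_LJ(dist p z) = inLayerInteraction V_LJ a
     + Σ'_{k ≠ m} layerInteraction V_LJ a (H k − H m) (haggLabel s k − haggLabel s m) 1`.

Mechanism (the `tsum_points_eq_two_mul_barlowSiteEnergy` bookkeeping of
`MinMeanCycleStackingLockBarlowEnergyIdentification.lean`, at arbitrary heights).  The spacings are
`≥ g := 39a/50 > 0` and `a > 0`, so distinct indices give points at distance `≥ min a g > 0`
(`le_dist_barlowPosH`, `le_dist_of_mem_barlowStackingH`): the parametrisation
`(k, i', j') ↦ barlowPosH a H s k i' j'` of the multilattice by `ℤ³` is a bijection and the point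
set is `min a g`-separated, whence the first conjunct (`summable_lennardJones_site`).  Transported
to `ℤ³` (the missing diagonal term is `V_LJ(0) = 0`) the family is summable, so its sum may be
computed layer by layer (`Summable.tsum_prod`); since
`barlowPosH k i' j' − p = layerVec a (H k − H m) (haggLabel s k − haggLabel s m) 1 (i'−i) (j'−j)`
the fibre over `k` is, after the in-layer translation `(i', j') ↦ (i' − i, j' − j)`, the lattice sum
`layerInteraction V_LJ a (H k − H m) (haggLabel s k − haggLabel s m) 1`, and for `k = m` this is
`layerInteraction V_LJ a 0 0 1 = inLayerInteraction V_LJ a` (again `V_LJ(0) = 0`;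
`LayeredHull.cake_layerInteraction_self`).  Splitting off the term `k = m`
(`Summable.tsum_eq_add_tsum_ite`) gives the identity and the summability of the layer series.
All [folklore].
-/

noncomputable section

namespace Summit.AtomisticToContinuum.Crystallization.Theorems.HcpLandscapeGapBirth

open Literature.MathematicalPhysics.StatisticalMechanics
open Summit.AtomisticToContinuum.Crystallization.Theorems

namespace SiteEnergyHeights

variable {a : ℝ} {H : ℤ → ℝ} {s : ℤ → ℤ}

/-! ### Geometry of the multilattice: differences are `layerVec`s, injectivity -/

/-- Differences of multilattice points are `layerVec`s at unit layer distance with "spacing" the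
height difference: `barlowPosH k i' j' − barlowPosH m i j
= layerVec a (H k − H m) (L k − L m) 1 (i' − i) (j' − j)`. [folklore] -/
theorem barlowPosH_sub_barlowPosH (a : ℝ) (H : ℤ → ℝ) (s : ℤ → ℤ) (m i j k i' j' : ℤ) :
    barlowPosH a H s k i' j' - barlowPosH a H s m i j =
      layerVec a (H k - H m) (haggLabel s k - haggLabel s m) 1 (i' - i) (j' - j) := by
  ext l
  fin_cases l
  · simp only [Fin.zero_eta, Fin.isValue, PiLp.sub_apply, barlowPosH_apply_zero,
      layerVec_apply_zero, Int.cast_sub]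
    ring
  · simp only [Fin.mk_one, Fin.isValue, PiLp.sub_apply, barlowPosH_apply_one,
      layerVec_apply_one, Int.cast_sub]
    ring
  · simp only [Fin.reduceFinMk, Fin.isValue, PiLp.sub_apply, barlowPosH_apply_two,
      layerVec_apply_two, Int.cast_one, one_mul]

/-- Distances of multilattice points are norms of `layerVec`s. [folklore] -/
theorem dist_barlowPosH_eq_norm_layerVec (a : ℝ) (H : ℤ → ℝ) (s : ℤ → ℤ) (m i j k i' j' : ℤ) :
    dist (barlowPosH a H s m i j) (barlowPosH a H s k i' j') =
      ‖layerVec a (H k - H m) (haggLabel s k - haggLabel s m) 1 (i' - i) (j' - j)‖ := by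
  rw [dist_comm, dist_eq_norm, barlowPosH_sub_barlowPosH]

/-- For `a > 0` and heights with gaps `≥ g > 0`, the parametrisation
`(k, i, j) ↦ barlowPosH a H s k i j` of the multilattice by `ℤ³` is injective (distinct indices
give points at distance `≥ min a g > 0`). [folklore] -/
theorem barlowPosH_injective (ha : 0 < a) {g : ℝ} (hg : 0 < g)
    (hgap : ∀ k : ℤ, g ≤ H (k + 1) - H k) (s : ℤ → ℤ) :
    Function.Injective fun q : ℤ × ℤ × ℤ => barlowPosH a H s q.1 q.2.1 q.2.2 := by
  intro q q' hqq'
  by_contra hne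
  have hle := le_dist_barlowPosH a H s ha.le hg.le hgap (k := q.1) (i := q.2.1) (j := q.2.2)
    (k' := q'.1) (i' := q'.2.1) (j' := q'.2.2) hne
  have h0 : barlowPosH a H s q.1 q.2.1 q.2.2 = barlowPosH a H s q'.1 q'.2.1 q'.2.2 := hqq'
  rw [h0, dist_self] at hle
  exact absurd hle (not_le.2 (lt_min ha hg))

/-- The multilattice with `a ≥ 0` and gaps `≥ g ≥ 0` is `min a g`-separated, in the form consumed
by `summable_lennardJones_site`. [folklore] -/
theorem separated_barlowStackingH (ha : 0 ≤ a) {g : ℝ} (hg : 0 ≤ g)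
    (hgap : ∀ k : ℤ, g ≤ H (k + 1) - H k) :
    ∀ x ∈ barlowStackingH a H s, ∀ y ∈ barlowStackingH a H s, x ≠ y → min a g ≤ dist x y :=
  fun _ hx _ hy hxy => le_dist_of_mem_barlowStackingH a H s ha hg hgap hx hy hxy

/-! ### The site sum: over the point set, over `ℤ³`, layer by layer -/

/-- **Summability of the site family over the point set**: for `a > 0`, gaps `≥ g > 0` and a
multilattice point `p = barlowPosH a H s m i j`, `z ↦ V_LJ(dist p z)` is summable over the other
points of the multilattice (a `min a g`-separated subset of `ℝ³`). [folklore] -/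
theorem summable_lennardJones_points (ha : 0 < a) {g : ℝ} (hg : 0 < g)
    (hgap : ∀ k : ℤ, g ≤ H (k + 1) - H k) (m i j : ℤ) :
    Summable fun z : ↥({z : EuclideanSpace ℝ (Fin 3) |
        z ∈ barlowStackingH a H s ∧ z ≠ barlowPosH a H s m i j} : Set (EuclideanSpace ℝ (Fin 3))) =>
      lennardJones (dist (barlowPosH a H s m i j) (z : EuclideanSpace ℝ (Fin 3))) :=
  HullBulkOptimal.summable_lennardJones_site (lt_min ha hg)
    (separated_barlowStackingH ha.le hg.le hgap) (barlowPosH_mem m i j)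

/-- **Summability of the site family in the parametrisation by `ℤ³`**: for `a > 0`, gaps
`≥ g > 0` and a multilattice point `p = barlowPosH a H s m i j`,
`(k, i', j') ↦ V_LJ (dist p (barlowPosH a H s k i' j'))` is summable (transport along the injective
parametrisation; the one extra index `(m, i, j)` is harmless). [folklore] -/
theorem summable_lennardJones_barlowPosH (ha : 0 < a) {g : ℝ} (hg : 0 < g)
    (hgap : ∀ k : ℤ, g ≤ H (k + 1) - H k) (m i j : ℤ) :
    Summable fun q : ℤ × ℤ × ℤ =>
      lennardJones (dist (barlowPosH a H s m i j) (barlowPosH a H s q.1 q.2.1 q.2.2)) := by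
  have hF := summable_lennardJones_points (s := s) ha hg hgap m i j
  set x := barlowPosH a H s m i j with hxdef
  set G : ℤ × ℤ × ℤ → EuclideanSpace ℝ (Fin 3) := fun q => barlowPosH a H s q.1 q.2.1 q.2.2
    with hGdef
  have hG : Function.Injective G := barlowPosH_injective ha hg hgap s
  -- the (at most one) index whose point is `x` itself
  have hS : (G ⁻¹' {x}).Finite := (Set.subsingleton_singleton.preimage hG).finite
  have hmem : ∀ q, G q ∈ barlowStackingH a H s := fun q => barlowPosH_mem _ _ _
  let φ : ↥(G ⁻¹' {x})ᶜ →
      ↥({z : EuclideanSpace ℝ (Fin 3) | z ∈ barlowStackingH a H s ∧ z ≠ x} :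
        Set (EuclideanSpace ℝ (Fin 3))) :=
    fun c => ⟨G c.1, hmem c.1, fun hc => c.2 hc⟩
  have hφ : Function.Injective φ := by
    intro c c' hcc'
    have h1 : G c.1 = G c'.1 := congrArg Subtype.val hcc'
    exact Subtype.ext (hG h1)
  have h1 : Summable ((fun z : ↥({z : EuclideanSpace ℝ (Fin 3) |
      z ∈ barlowStackingH a H s ∧ z ≠ x} : Set (EuclideanSpace ℝ (Fin 3))) =>
        lennardJones (dist x z.1)) ∘ φ) :=
    hF.comp_injective hφ
  have h2 : Summable ((fun q : ℤ × ℤ × ℤ => lennardJones (dist x (G q))) ∘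
      ((↑) : ↥(G ⁻¹' {x})ᶜ → ℤ × ℤ × ℤ)) := h1
  exact hS.summable_compl_iff.1 h2

/-- **The punctured site sum over the point set is the full `ℤ³`-parametrised sum** (the
parametrisation is a bijection onto the multilattice; the missing diagonal term is `V_LJ(0) = 0`).
[folklore] -/
theorem tsum_points_eq_tsum_barlowPosH (ha : 0 < a) {g : ℝ} (hg : 0 < g)
    (hgap : ∀ k : ℤ, g ≤ H (k + 1) - H k) (m i j : ℤ) :
    ∑' z : ↥({z : EuclideanSpace ℝ (Fin 3) |
        z ∈ barlowStackingH a H s ∧ z ≠ barlowPosH a H s m i j} : Set (EuclideanSpace ℝ (Fin 3))),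
      lennardJones (dist (barlowPosH a H s m i j) (z : EuclideanSpace ℝ (Fin 3))) =
      ∑' q : ℤ × ℤ × ℤ,
        lennardJones (dist (barlowPosH a H s m i j) (barlowPosH a H s q.1 q.2.1 q.2.2)) := by
  set x := barlowPosH a H s m i j with hxdef
  set G : ℤ × ℤ × ℤ → EuclideanSpace ℝ (Fin 3) := fun q => barlowPosH a H s q.1 q.2.1 q.2.2
    with hGdef
  have hG : Function.Injective G := barlowPosH_injective ha hg hgap s
  set q₀ : ℤ × ℤ × ℤ := (m, i, j) with hq₀
  have hx : G q₀ = x := rfl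
  have hmem : ∀ q, G q ∈ barlowStackingH a H s := fun q => barlowPosH_mem _ _ _
  let φ : ↥({q₀}ᶜ : Set (ℤ × ℤ × ℤ)) →
      ↥({z : EuclideanSpace ℝ (Fin 3) | z ∈ barlowStackingH a H s ∧ z ≠ x} :
        Set (EuclideanSpace ℝ (Fin 3))) :=
    fun c => ⟨G c.1, hmem c.1, fun hc => c.2 (hG (hc.trans hx.symm))⟩
  have hφ : Function.Injective φ := by
    intro c c' hcc'
    have h1 : G c.1 = G c'.1 := congrArg Subtype.val hcc'
    exact Subtype.ext (hG h1)
  -- `φ` is onto: every point of the multilattice is some `barlowPosH k i' j'`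
  have hsurj : Function.support
      (fun z : ↥({z : EuclideanSpace ℝ (Fin 3) | z ∈ barlowStackingH a H s ∧ z ≠ x} :
        Set (EuclideanSpace ℝ (Fin 3))) => lennardJones (dist x z.1)) ⊆ Set.range φ := by
    intro z _
    obtain ⟨k, i', j', hk⟩ := z.2.1
    have hne : ((k, i', j') : ℤ × ℤ × ℤ) ∈ ({q₀}ᶜ : Set (ℤ × ℤ × ℤ)) := by
      intro hq
      have hq' : G (k, i', j') = G q₀ := by rw [Set.mem_singleton_iff.1 hq]
      exact z.2.2 (hk.trans (hq'.trans hx))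
    exact ⟨⟨(k, i', j'), hne⟩, Subtype.ext hk.symm⟩
  have key := hφ.tsum_eq hsurj
  rw [← key]
  have h0 : Function.support (fun q : ℤ × ℤ × ℤ => lennardJones (dist x (G q))) ⊆
      ({q₀}ᶜ : Set (ℤ × ℤ × ℤ)) := by
    intro q hq
    rw [Function.mem_support] at hq
    simp only [Set.mem_compl_iff, Set.mem_singleton_iff]
    rintro rfl
    exact hq (by simp only [hx, dist_self, lennardJones_zero])
  exact tsum_subtype_eq_of_support_subset h0

/-- **The interaction of `p = barlowPosH m i j` with the whole layer `k`** is the lattice sum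
`layerInteraction V a (H k − H m) (L k − L m) 1` (in-layer translation
`(i', j') ↦ (i' − i, j' − j)`; any pair potential `V`). [folklore] -/
theorem tsum_layerH (V : ℝ → ℝ) (a : ℝ) (H : ℤ → ℝ) (s : ℤ → ℤ) (m i j k : ℤ) :
    ∑' ij : ℤ × ℤ, V (dist (barlowPosH a H s m i j) (barlowPosH a H s k ij.1 ij.2)) =
      layerInteraction V a (H k - H m) (haggLabel s k - haggLabel s m) 1 := by
  unfold layerInteraction
  rw [← (Equiv.addRight ((i, j) : ℤ × ℤ)).tsum_eq fun ij : ℤ × ℤ =>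
    V (dist (barlowPosH a H s m i j) (barlowPosH a H s k ij.1 ij.2))]
  refine tsum_congr fun ij => ?_
  simp only [Equiv.coe_addRight, Prod.fst_add, Prod.snd_add]
  rw [dist_barlowPosH_eq_norm_layerVec, add_sub_cancel_right, add_sub_cancel_right]

end SiteEnergyHeights

open SiteEnergyHeights in
/-- **Stub RS — site energy of a Barlow multilattice point, layer by layer.**  For
`a ∈ [47/50, 1]`, a Hägg word `s`, heights `H` with spacings in `[39a/50, 17a/20]` and a point
`p = barlowPosH a H s m i j`: the family `z ↦ V_LJ(dist p z)` over the other points of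
`barlowStackingH a H s` is summable, the layer series is summable, and
`Σ'_{z ≠ p} V_LJ(dist p z) = inLayerInteraction V_LJ a
  + Σ'_{k ≠ m} layerInteraction V_LJ a (H k − H m) (haggLabel s k − haggLabel s m) 1`
(regroup the absolutely summable family over `(k, i', j')` by layers; in-layer translation by
`(i, j)`; `barlowPosH k i' j' − p = layerVec a (H k − H m) (L k − L m) 1 (i' − i) (j' − j)`; the
hypotheses on `a`, `s` and the spacing band enter only through `a > 0` and gaps `≥ 39a/50 > 0`).
[folklore] -/
theorem stub_siteEnergyHeights : ∀ (a : ℝ), 47 / 50 ≤ a → a ≤ 1 → ∀ s : ℤ → ℤ, Literature.MathematicalPhysics.StatisticalMechanics.IsHaggSeq s → ∀ H : ℤ → ℝ, (∀ k : ℤ, 39 / 50 * a ≤ H (k + 1) - H k ∧ H (k + 1) - H k ≤ 17 / 20 * a) → ∀ m i j : ℤ, Summable (fun z : ↥{z : EuclideanSpace ℝ (Fin 3) | z ∈ Literature.MathematicalPhysics.StatisticalMechanics.barlowStackingH a H s ∧ z ≠ Literature.MathematicalPhysics.StatisticalMechanics.barlowPosH a H s m i j} => Literature.MathematicalPhysics.StatisticalMechanics.lennardJones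 (dist (Literature.MathematicalPhysics.StatisticalMechanics.barlowPosH a H s m i j) (z : EuclideanSpace ℝ (Fin 3)))) ∧ Summable (fun k : ℤ => if k = m then (0 : ℝ) else Literature.MathematicalPhysics.StatisticalMechanics.layerInteraction Literature.MathematicalPhysics.StatisticalMechanics.lennardJones a (H k - H m) (Literature.MathematicalPhysics.StatisticalMechanics.haggLabel s k - Literature.MathematicalPhysics.StatisticalMechanics.haggLabel s m) 1) ∧ (∑' z : ↥{z : EuclideanSpace ℝ (Fin 3) | z ∈ Literature.MathematicalPhysics.StatisticalMechanics.barlowStackingH a H s ∧ z ≠ Literature.MathematicalPhysics.StatisticalMechanics.barlowPosH a H s m i j}, Literature.MathematicalPhysics.StatisticalMechanics.lennardJones (dist (Literature.MathematicalPhysics.StatisticalMechanics.barlowPosH a H s m i j) (z : EuclideanSpace ℝ (Fin 3)))) = Literature.MathematicalPhysics.StatisticalMechanics.inLayerInteraction Literature.MathematicalPhysics.StatisticalMechanics.lennardJones a + ∑' k : ℤ, (if k = m then (0 : ℝ) else Literature.MathematicalPhysics.StatisticalMechanics.layerInteraction Literature.MathematicalPhysics.StatisticalMechanics.lennardJones a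 (H k - H m) (Literature.MathematicalPhysics.StatisticalMechanics.haggLabel s k - Literature.MathematicalPhysics.StatisticalMechanics.haggLabel s m) 1) := by
  intro a ha _ s _ H hband m i j
  have ha0 : 0 < a := by linarith
  have hg : 0 < 39 / 50 * a := by positivity
  have hgap : ∀ k : ℤ, 39 / 50 * a ≤ H (k + 1) - H k := fun k => (hband k).1
  -- the `ℤ³`-parametrised family and its layer sums
  have hF := summable_lennardJones_barlowPosH (s := s) ha0 hg hgap m i j
  have hL : Summable fun k : ℤ =>
      layerInteraction lennardJones a (H k - H m) (haggLabel s k - haggLabel s m) 1 :=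
    hF.prod.congr fun k => tsum_layerH lennardJones a H s m i j k
  have e1 : ∑' q : ℤ × ℤ × ℤ,
      lennardJones (dist (barlowPosH a H s m i j) (barlowPosH a H s q.1 q.2.1 q.2.2)) =
      ∑' k : ℤ, layerInteraction lennardJones a (H k - H m) (haggLabel s k - haggLabel s m) 1 :=
    hF.tsum_prod.trans (tsum_congr fun k => tsum_layerH lennardJones a H s m i j k)
  -- split off the layer `k = m`, whose sum is the punctured in-layer sum
  have e2 := hL.tsum_eq_add_tsum_ite m
  have e0 : layerInteraction lennardJones a (H m - H m) (haggLabel s m - haggLabel s m) 1 =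
      inLayerInteraction lennardJones a := by
    rw [sub_self, sub_self, LayeredHull.cake_layerInteraction_self]
  refine ⟨summable_lennardJones_points ha0 hg hgap m i j,
    (hasSum_ite_sub_hasSum hL.hasSum m).summable, ?_⟩
  rw [tsum_points_eq_tsum_barlowPosH ha0 hg hgap, e1, e2, e0]

end Summit.AtomisticToContinuum.Crystallization.Theorems.HcpLandscapeGapBirth

end
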